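import Summits.QuantumFields.BalabanUV.Beta.GAN24.CouplingWordsAtCouplingDecay
import Summits.QuantumFields.BalabanUV.Beta.GAN24.CouplingPerturbedVolumeLimit

/-!
# `BalabanUV.Beta.GAN24.CouplingWordsAtCouplingVolumeLimit` — binder row G-an2-4 ∕ (CONV-C), route R7 «TWO CURRENCIES», PART 263: EL₂ OF EVERY WORD IN COUPLING LETTERS AT A BASE
# POINT, MODULO ONLY THE BACKGROUNDS' POINTWISE LIMITS, AND THE INPUT TRIPLE.  `T_{w,k}(u) = 𝒢_k(u)A_{i₁,k}𝒢_k(u)⋯𝒢_k(u)`, `𝒢_k(u) = (Δ_a^{(k)} + u·A₀^{(k)})⁻¹` for a SMALL base coupling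
# letter `A₀ = P(U₁) + P(U₂)ᴴ + diag Z` and an arbitrary family of coupling letters `A_i = P(V₁ᵢ) + P(V₂ᵢ)ᴴ + diag Wᵢ` (the class of `Δ^U − Δ^1`): (§1) the perturbed fine propagator
# `𝒢_k(u)` decays in the block ∕ fine-window currencies VOLUME-FREE on the base letter's disc (PART 162 §2 for a coupling letter: NE2's weighted coercivity of `Δ_a`, PART 236's conjugated
# coupling letter, the conjugated Neumann bound, `pairing_le_of_opNorm_conjMat` with indicator vectors); (§2) `T_w(u) = 𝒢(u)·R_w(u)` with left-window-decaying letters `A_i𝒢(u)`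
# having EL₂ (PART 236's stencil on §1 and on PART 249's `tendsto_pertInv_pair_coupling`), so PART 159 §1's `tendsto_mul_tailWord_pair` gives EL₂ of `T_w(u)` at fine pairs and PART
# 151's middle-free stencil lifts it to `X_{w,k}(u) = L^{dk}Q_kT_{w,k}(u)Q_kᴴ`; (§3) with PART 262's (UD)+(SR): the INPUT triple of `X_w(u)` along the even cubic volumes, the format of
# PART 160's `list_prod_inputs` (PART 237 is `u = 0`, PART 162 the first-order chains) (unit b2b-balaban-gan24-p3, gen 67; v1)

NOT IN PRINT; OUR PROOF ([folklore] bookkeeping BY NAME over PART 262 (`couplingWordAt_decay_inputs`), PART 249 (`tendsto_pertInv_pair_coupling`), PART 236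
(`norm_couplingLetter_mul_apply_le`, `tendsto_couplingLetter_mul_pair`, `hPc_couplingLetter`), PART 162 (`windowDecay_of_blockDecay`), PART 159 (`tendsto_mul_tailWord_pair`), PART
151 (`tendsto_avgTow_pair_of_fine`), PART 145 (`single_pairing`, `nsq_single`, `wCoercive_sub_const`), PART 126 (`conjMat_sub_const`, `rho_le_one_of_near`,
`distK_sub_three_le_rho_of_near`), PART 122 (`chain_eq_mul_tailProd`), NE2's `wCoercive_calDa_of_conjDefect`, `opNorm_conjMat_pertInv_le_of_wCoercive`,
`pairing_le_of_opNorm_conjMat`; [Balaban1984PropagatorsI] Prop. 1.1 (1.89) p. 33 LOCATES the decay of `G`; [Balaban1987RG1] p. 264 LOCATES the `T ↗ ℤ^d` limit; nothing printed is a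
hypothesis).
HONEST FRAMING (cell contract, verbatim): «discharging `BetaPertH` makes Bałaban's UV stability UNCONDITIONAL — a real constructive-QFT result; it is NOT the
continuum limit and NOT the Clay problem.»  HONEST DEPENDENCY (verbatim): «continuum YM on T⁴ ⇐ BetaPertH ∧ nine spine estimates (0/9 proved); BetaPertH ⇐
(D1) ∧ (D4) ∧ CAP+tail; G-an2-4 gates asym, D1 and NE2/3/4.»

WHAT THIS FILE PROVES (0 sorry, 0 `def`; admissible `(a′, κ)`, base constants `(α₀, β₀, α₀′, β₀′)` with `Tκ₀ ≤ 1∕2`, `Tκ_c ≤ 1∕2`, `‖u‖ ≤ T`; family constants `(α, β, α′, β′)`):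
* §1 **`blockDecay_pertInv_coupling`** (every torus: `‖𝒢_k(u)((w,λ),(y,ν))‖ ≤ 2e^{4κ}∕(γ_D − J)·e^{−κ·tdist(blocks)}`), **`fineWindowDecay_pertInv_coupling`** (cubic tori, fine window).
* §2 (`d ≥ 3`, even cubic volumes, EL₁ of all backgrounds displayed) **`tendsto_couplingWordAt_fine_pair`**, **`tendsto_couplingWordAt_pair`** (EL₂ of `T_w(u)` ∕ `X_w(u)`, every word).
* §3 **`couplingWordAt_inputs`** — the INPUT triple ((UD), (SR), EL₂) of `X_w(u)` along the even cubic volumes, `u`-uniform constants.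
WHAT IT DOES NOT DO: the letter `c_k(u)⁻¹` and the diagrams at the base point (next PART); couplings outside the disc; colour.  SUPPLIER work; NEVER «G-an2-4 closed»; NOT (CONV-C),
NOT D1, NOT `BetaPertH`, NOT continuum, NOT Clay.  Records: `HOME/b2b-balaban-gan24-p3/gen67/README.md`.
-/

noncomputable section

open scoped BigOperators ComplexConjugate Matrix Matrix.Norms.L2Operator
open Filter Topology

namespace Summit.QuantumFields.BalabanUV.Beta.GAN24.CouplingWordsAtCouplingVolumeLimit

open Literature.MathematicalPhysics.QuantumFieldTheory.Balaban1983to89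
open Literature.MathematicalPhysics.QuantumFieldTheory.Balaban1983to89.B5Prop11Plancherel (Tor fine Cst Cst_nonneg)
open Literature.MathematicalPhysics.QuantumFieldTheory.Balaban1983to89.B5Prop11Lower (nsq)
open Literature.MathematicalPhysics.QuantumFieldTheory.Balaban1983to89.B5G183RateUnitTower (lev)
open Literature.MathematicalPhysics.QuantumFieldTheory.Balaban1983to89.B12Sec2to5 (l1)
open Literature.MathematicalPhysics.QuantumFieldTheory.Balaban1983to89.Beta (Site windowMap)
open Literature.MathematicalPhysics.QuantumFieldTheory.Balaban1983to89.Beta.FreeLegDictionary (cubic)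
open Literature.MathematicalPhysics.QuantumFieldTheory.Balaban1983to89.Beta.BlockKernelVolumeSockets (evenPeriod tendsto_evenPeriod)
open Literature.MathematicalPhysics.QuantumFieldTheory.Balaban1983to89.Beta.VectorTails (castT)
open Literature.MathematicalPhysics.QuantumFieldTheory.Balaban1983to89.Beta.VectorTailsCov (tdist tdist_self)
open Summit.QuantumFields.BalabanUV.T4Continuum
open Summit.QuantumFields.BalabanUV.T4Continuum.CovariantAveragingTower (avgTow TowerLimitRate)
open Summit.QuantumFields.BalabanUV.T4Continuum.BalabanAveragedTowerUnit (idx QBlev calGlev one_le_lev')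
open Summit.QuantumFields.BalabanUV.T4Continuum.BalabanAveragedCoerciveTower (unitIdx)
open Summit.QuantumFields.BalabanUV.T4Continuum.KingPairingPlantedLaw (calDalev)
open Summit.QuantumFields.BalabanUV.T4Continuum.FirstOrderBackgroundModel (LipschitzBackground Pmodel)
open Summit.QuantumFields.BalabanUV.T4Continuum.PerturbationAlgebra (BoundedBackground)
open Summit.QuantumFields.BalabanUV.T4Continuum.CTWeightedCoercivity (conjMat WCoercive)
open Summit.QuantumFields.BalabanUV.T4Continuum.CTAveragedTowerDecay (opNorm_conjMat_pertInv_le_of_wCoercive pairing_le_of_opNorm_conjMat)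
open Summit.QuantumFields.BalabanUV.T4Continuum.CTKingTowerWeights (rho distK toM)
open Summit.QuantumFields.BalabanUV.T4Continuum.CTConjugatedHbd (G2 G2_nonneg wCoercive_calDa_of_conjDefect)
open Summit.QuantumFields.BalabanUV.T4Continuum.CTConjDefectDischarge (conjDefect_calDalev_rho max_JA_lt_gamD)
open Summit.QuantumFields.BalabanUV.T4Continuum.DirichletRegionTower (gamD)
open Summit.QuantumFields.BalabanUV.T4Continuum.ScalarAveragedPropagator (gammaPs)
open Summit.QuantumFields.BalabanUV.T4Continuum.ScalarAveragedCompression (sigma0)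
open Summit.QuantumFields.BalabanUV.T4Continuum.CTScalarGreen (Jfree)
open Summit.QuantumFields.BalabanUV.T4Continuum.CTGaugeTerm (deltaK)
open Summit.QuantumFields.BalabanUV.T4Continuum.CTVectorPropagator (JA)
open Summit.QuantumFields.BalabanUV.T4Continuum.DecayRateInterpolation (EntryDecay TwoLevelDecayRate)
open Summit.QuantumFields.BalabanUV.Beta.GAN24.UnitLatticeDecayAlgebra (toM_bijective)
open Summit.QuantumFields.BalabanUV.Beta.GAN24.InsertionChainDecayBalaban (conjMat_sub_const rho_le_one_of_near distK_sub_three_le_rho_of_near)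
open Summit.QuantumFields.BalabanUV.Beta.GAN24.InsertionChainLawWords (chain_eq_mul_tailProd)
open Summit.QuantumFields.BalabanUV.Beta.GAN24.DiagramVolumeLimitPairs (l1_windowMap_neg)
open Summit.QuantumFields.BalabanUV.Beta.GAN24.FinePropagatorDecay (single_pairing nsq_single wCoercive_sub_const)
open Summit.QuantumFields.BalabanUV.Beta.GAN24.PerturbedPropagatorVolumeLimit (tendsto_avgTow_pair_of_fine)
open Summit.QuantumFields.BalabanUV.Beta.GAN24.InsertionWordVolumeLimit (tendsto_mul_tailWord_pair)
open Summit.QuantumFields.BalabanUV.Beta.GAN24.PerturbedInsertionChainDecay (windowDecay_of_blockDecay)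
open Summit.QuantumFields.BalabanUV.Beta.GAN24.CouplingLetterStencil (norm_couplingLetter_mul_apply_le tendsto_couplingLetter_mul_pair hPc_couplingLetter)
open Summit.QuantumFields.BalabanUV.Beta.GAN24.CouplingPerturbedVolumeLimit (tendsto_pertInv_pair_coupling)
open Summit.QuantumFields.BalabanUV.Beta.GAN24.CouplingWordsAtCouplingDecay (couplingWordAt_decay_inputs)

variable {d : ℕ} (L : ℕ) [NeZero L] (a : ℝ) (ha : 0 < a)

/-! ## §1 The perturbed fine propagator for a coupling letter decays, volume-free -/

section FineDecay

/-- **`blockDecay_pertInv_coupling` — THE PERTURBED FINE PROPAGATOR's BLOCK DECAY FOR A COUPLING LETTER, VOLUME-FREE** [our proof] (every torus `M`, level `k`, base coupling letter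
`A₀ = P(U₁) + P(U₂)ᴴ + diag Z` with constants `(α₀, β₀, α₀′, β₀′)`, admissible `(a′, κ)`, `‖u‖ ≤ T`, `T·κ_c ≤ 1∕2`):
`‖(Δ_a^{(k)} + uA₀^{(k)})⁻¹((w,λ),(y,ν))‖ ≤ 2e^{4κ}∕(γ_D − J)·e^{−κ·tdist(blockOf w, blockOf y)}` — PART 162's `blockDecay_pertInv` with PART 236's conjugated coupling letter.
[cite: Balaban1984PropagatorsI, Prop. 1.1 (1.89) p.33 (decay of `G`: the object)] -/
theorem blockDecay_pertInv_coupling {α₀ β₀ α₀' β₀' a' κ T : ℝ} (ha' : 0 < a') (hκ0 : 0 < κ)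
    (hγ' : Jfree d a' κ 1 < gammaPs d a') (hδ' : deltaK d a' κ 1 < sigma0 d a' ^ 2) (hJA : JA d a a' κ 1 < gamD d a)
    (hT₂ : T * (d * (α₀ * G2 d a (max (JA d a a' κ 1) 0) (gamD d a - max (JA d a a' κ 1) 0) κ)
      + d * (Real.exp |κ| * (α₀ * G2 d a (max (JA d a a' κ 1) 0) (gamD d a - max (JA d a a' κ 1) 0) κ + β₀ * (gamD d a - max (JA d a a' κ 1) 0)⁻¹))
      + α₀' * (gamD d a - max (JA d a a' κ 1) 0)⁻¹) ≤ 1 / 2)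
    (M : Fin d → ℕ) [∀ μ, NeZero (M μ)] {U₁ U₂ : (k : ℕ) → Fin d → (idx L M k → ℂ)} {Z : (k : ℕ) → (idx L M k → ℂ)}
    (hU₁ : LipschitzBackground L M U₁ α₀ β₀) (hU₂ : LipschitzBackground L M U₂ α₀ β₀) (hZ : BoundedBackground L M Z α₀' β₀')
    {u : ℂ} (hu : ‖u‖ ≤ T) (k : ℕ) (w y : Tor (fine (lev L k) M)) (l ν : Fin d) :
    ‖(calDalev L M a ha k + u • (Pmodel L M U₁ k + (Pmodel L M U₂ k)ᴴ + Matrix.diagonal (Z k)))⁻¹ (w, l) (y, ν)‖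
      ≤ 2 * Real.exp (κ * 4) / (gamD d a - max (JA d a a' κ 1) 0)
        * Real.exp (-(κ * (tdist (B5Blocks16.blockOf (lev L k) M w) (B5Blocks16.blockOf (lev L k) M y) : ℝ))) := by
  set J : ℝ := max (JA d a a' κ 1) 0 with hJdef
  have hJ0 : 0 ≤ J := le_max_right _ _
  have hJγ : J < gamD d a := max_JA_lt_gamD a hJA
  set κc : ℝ := d * (α₀ * G2 d a J (gamD d a - J) κ) + d * (Real.exp |κ| * (α₀ * G2 d a J (gamD d a - J) κ + β₀ * (gamD d a - J)⁻¹)) + α₀' * (gamD d a - J)⁻¹ with hκc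
  have hα : 0 ≤ α₀ := hU₁.nonneg.1
  have hβ : 0 ≤ β₀ := hU₁.nonneg.2
  have hα' : 0 ≤ α₀' := hZ.nonneg.1
  have hγi : 0 ≤ (gamD d a - J)⁻¹ := inv_nonneg.mpr (sub_pos.mpr hJγ).le
  have hκc0 : 0 ≤ κc := by have := G2_nonneg (d := d) a J (sub_pos.mpr hJγ) κ; positivity
  have htc : ‖u‖ * κc < 1 := by nlinarith [mul_le_mul_of_nonneg_right hu hκc0, norm_nonneg u]
  have hνc : (1 - ‖u‖ * κc)⁻¹ ≤ 2 := by
    have h1 : (1 : ℝ) / 2 ≤ 1 - ‖u‖ * κc := by nlinarith [mul_le_mul_of_nonneg_right hu hκc0, norm_nonneg u]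
    have := inv_anti₀ (by norm_num : (0 : ℝ) < 1 / 2) h1
    rwa [one_div, inv_inv] at this
  -- unit sites labelling the two blocks; the weight centred at the block of `y`, shifted by `1`
  obtain ⟨x₀, hx₀⟩ := (toM_bijective L M).2 (B5Blocks16.blockOf (lev L k) M w)
  obtain ⟨y₀, hy₀⟩ := (toM_bijective L M).2 (B5Blocks16.blockOf (lev L k) M y)
  have hW : WCoercive (calDalev L M a ha k) κ (rho L M k (y₀, ν)) (gamD d a - J) :=
    wCoercive_calDa_of_conjDefect (lev L k) (one_le_lev' L k) M a ha (conjDefect_calDalev_rho L M a ha ha' hγ' hδ' k (y₀, ν))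
  have hW' := wCoercive_sub_const hW 1
  have hPc : ‖conjMat κ (fun e => rho L M k (y₀, ν) e - 1) (fun e => rho L M k (y₀, ν) e - 1) (Pmodel L M U₁ k + (Pmodel L M U₂ k)ᴴ + Matrix.diagonal (Z k))
      * conjMat κ (fun e => rho L M k (y₀, ν) e - 1) (fun e => rho L M k (y₀, ν) e - 1) (calDalev L M a ha k)⁻¹‖ ≤ κc := by
    rw [conjMat_sub_const, conjMat_sub_const]
    exact hPc_couplingLetter L M a ha hU₁ hU₂ hZ hJ0 hJγ k (y₀, ν) (conjDefect_calDalev_rho L M a ha ha' hγ' hδ' k (y₀, ν))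
  have hK := opNorm_conjMat_pertInv_le_of_wCoercive hW' (sub_pos.mpr hJγ) hPc htc
  have hK' : ‖conjMat κ (fun e => rho L M k (y₀, ν) e - 1) (fun e => rho L M k (y₀, ν) e - 1)
      (calDalev L M a ha k + u • (Pmodel L M U₁ k + (Pmodel L M U₂ k)ᴴ + Matrix.diagonal (Z k)))⁻¹‖ ≤ (gamD d a - J)⁻¹ * 2 :=
    hK.trans (mul_le_mul_of_nonneg_left hνc hγi)
  have hnear_w : tdist (toM L M (x₀, l).1) (B5Blocks16.blockOf (lev L k) M (w, l).1) ≤ 1 := by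
    simp only [hx₀, tdist_self]; exact zero_le_one
  have hnear_y : tdist (toM L M (y₀, ν).1) (B5Blocks16.blockOf (lev L k) M (y, ν).1) ≤ 1 := by
    simp only [hy₀, tdist_self]; exact zero_le_one
  have hu' : ∀ e : idx L M k, (Pi.single (w, l) (1 : ℂ) : idx L M k → ℂ) e ≠ 0 → distK L M (x₀, l) (y₀, ν) - 4 ≤ rho L M k (y₀, ν) e - 1 := by
    intro e he
    have : e = (w, l) := by by_contra hne; exact he (Pi.single_eq_of_ne hne _)
    subst this
    have := distK_sub_three_le_rho_of_near L M k (x₀, l) (y₀, ν) (w, l) hnear_w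
    linarith
  have hv' : ∀ e : idx L M k, (Pi.single (y, ν) (1 : ℂ) : idx L M k → ℂ) e ≠ 0 → rho L M k (y₀, ν) e - 1 ≤ 0 := by
    intro e he
    have : e = (y, ν) := by by_contra hne; exact he (Pi.single_eq_of_ne hne _)
    subst this
    have := rho_le_one_of_near L M k (y₀, ν) (y, ν) hnear_y
    linarith
  have h := pairing_le_of_opNorm_conjMat hκ0.le hK' hu' hv'
  rw [single_pairing, nsq_single, nsq_single, Real.sqrt_one, mul_one, mul_one] at h
  refine h.trans (le_of_eq ?_)
  have hdist : distK L M (x₀, l) (y₀, ν) = (tdist (B5Blocks16.blockOf (lev L k) M w) (B5Blocks16.blockOf (lev L k) M y) : ℝ) := by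
    unfold distK; rw [hx₀, hy₀]
  rw [hdist, show -(κ * ((tdist (B5Blocks16.blockOf (lev L k) M w) (B5Blocks16.blockOf (lev L k) M y) : ℝ) - 4))
      = κ * 4 + -(κ * (tdist (B5Blocks16.blockOf (lev L k) M w) (B5Blocks16.blockOf (lev L k) M y) : ℝ)) by ring, Real.exp_add]
  ring

/-- **`fineWindowDecay_pertInv_coupling` — THE PERTURBED FINE PROPAGATOR's WINDOW DECAY AT PAIRS ON CUBIC TORI FOR A COUPLING LETTER, VOLUME-FREE** [our proof]: on every cubic
torus `(ℤ∕s)^d`, level `k`, base coupling letter with constants `(α₀, β₀, α₀′, β₀′)` and coupling `‖u‖ ≤ T` of the disc,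
`‖(Δ_a^{(k)} + uA₀^{(k)})⁻¹((w,λ),(y,ν))‖ ≤ (2e^{4κ}∕(γ_D − J))·e^{κ}·e^{−(κ∕(d n_k))|windowMap(w − y)|₁}` — §1 through PART 162's `windowDecay_of_blockDecay`. -/
theorem fineWindowDecay_pertInv_coupling {α₀ β₀ α₀' β₀' a' κ T : ℝ} (ha' : 0 < a') (hκ0 : 0 < κ)
    (hγ' : Jfree d a' κ 1 < gammaPs d a') (hδ' : deltaK d a' κ 1 < sigma0 d a' ^ 2) (hJA : JA d a a' κ 1 < gamD d a)
    (hT₂ : T * (d * (α₀ * G2 d a (max (JA d a a' κ 1) 0) (gamD d a - max (JA d a a' κ 1) 0) κ)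
      + d * (Real.exp |κ| * (α₀ * G2 d a (max (JA d a a' κ 1) 0) (gamD d a - max (JA d a a' κ 1) 0) κ + β₀ * (gamD d a - max (JA d a a' κ 1) 0)⁻¹))
      + α₀' * (gamD d a - max (JA d a a' κ 1) 0)⁻¹) ≤ 1 / 2)
    (s : ℕ) [NeZero s] {U₁ U₂ : (k : ℕ) → Fin d → (idx L (cubic d s) k → ℂ)} {Z : (k : ℕ) → (idx L (cubic d s) k → ℂ)}
    (hU₁ : LipschitzBackground L (cubic d s) U₁ α₀ β₀) (hU₂ : LipschitzBackground L (cubic d s) U₂ α₀ β₀) (hZ : BoundedBackground L (cubic d s) Z α₀' β₀')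
    {u : ℂ} (hu : ‖u‖ ≤ T) (k : ℕ) (w y : Tor (fine (lev L k) (cubic d s))) (l ν : Fin d) :
    ‖(calDalev L (cubic d s) a ha k + u • (Pmodel L (cubic d s) U₁ k + (Pmodel L (cubic d s) U₂ k)ᴴ + Matrix.diagonal (Z k)))⁻¹ (w, l) (y, ν)‖
      ≤ 2 * Real.exp (κ * 4) / (gamD d a - max (JA d a a' κ 1) 0) * Real.exp κ * Real.exp (-(κ / (d * lev L k)) * l1 (windowMap d (lev L k * s) (w - y))) := by
  have hJγ : max (JA d a a' κ 1) 0 < gamD d a := max_JA_lt_gamD a hJA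
  have hA : 0 ≤ 2 * Real.exp (κ * 4) / (gamD d a - max (JA d a a' κ 1) 0) := by have := sub_pos.mpr hJγ; positivity
  exact (blockDecay_pertInv_coupling L a ha ha' hκ0 hγ' hδ' hJA hT₂ (cubic d s) hU₁ hU₂ hZ hu k w y l ν).trans (windowDecay_of_blockDecay hκ0 hA (lev L k) s w y)

end FineDecay

/-! ## §2 EL₂ of every word at the base point, modulo the backgrounds' pointwise limits -/

section WordLimits

/-- **`tendsto_couplingWordAt_fine_pair` — EL₂ OF THE FINE KERNEL `T_{w,k}(u) = 𝒢(u)A_{i₁}𝒢(u)⋯𝒢(u)` AT FINE INTEGER PAIRS, EVERY WORD, MODULO EL₁ OF ALL BACKGROUNDS** [our proof]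
(`d ≥ 3`, `a > 0`, level `k`, even cubic volumes; base coupling letter `(α₀, β₀, α₀′, β₀′)` on its disc, `‖u‖ ≤ T`; a family of coupling letters with common `(α, β, α′, β′)`,
`α, α′ ≥ 0`): `T_w(u) = 𝒢(u)·R_w(u)`, each letter `A_i𝒢(u)` left-window-decaying volume-free (PART 236 on §1) with EL₂ (PART 236 on PART 249), so PART 159 §1 applies.
[cite: Balaban1987RG1, p.264 (after (1.21): the `T ↗ ℤ^d` limit)] -/
theorem tendsto_couplingWordAt_fine_pair (hd : 3 ≤ d) {α₀ β₀ α₀' β₀' α β α' β' a' κ T : ℝ} (hα : 0 ≤ α) (hα' : 0 ≤ α') (ha' : 0 < a') (hκ0 : 0 < κ)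
    (hγ' : Jfree d a' κ 1 < gammaPs d a') (hδ' : deltaK d a' κ 1 < sigma0 d a' ^ 2) (hJA : JA d a a' κ 1 < gamD d a)
    (hT₁ : T * (2 * (d * (α₀ + β₀) * Cst d a) + α₀' * Cst d a) ≤ 1 / 2)
    (hT₂ : T * (d * (α₀ * G2 d a (max (JA d a a' κ 1) 0) (gamD d a - max (JA d a a' κ 1) 0) κ)
      + d * (Real.exp |κ| * (α₀ * G2 d a (max (JA d a a' κ 1) 0) (gamD d a - max (JA d a a' κ 1) 0) κ + β₀ * (gamD d a - max (JA d a a' κ 1) 0)⁻¹))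
      + α₀' * (gamD d a - max (JA d a a' κ 1) 0)⁻¹) ≤ 1 / 2) (k : ℕ)
    {U₁ U₂ : (t : ℕ) → (k : ℕ) → Fin d → (idx L (cubic d (evenPeriod t)) k → ℂ)} {Z : (t : ℕ) → (k : ℕ) → (idx L (cubic d (evenPeriod t)) k → ℂ)}
    (hU₁ : ∀ t, LipschitzBackground L (cubic d (evenPeriod t)) (U₁ t) α₀ β₀) (hU₂ : ∀ t, LipschitzBackground L (cubic d (evenPeriod t)) (U₂ t) α₀ β₀)
    (hZ : ∀ t, BoundedBackground L (cubic d (evenPeriod t)) (Z t) α₀' β₀')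
    (hU₁1 : ∀ (μ f : Fin d) (z : Fin d → ℤ), ∃ s : ℂ, Tendsto (fun t => U₁ t k μ (castT (cubic d (lev L k * evenPeriod t)) z, f)) atTop (𝓝 s))
    (hU₂1 : ∀ (μ f : Fin d) (z : Fin d → ℤ), ∃ s : ℂ, Tendsto (fun t => U₂ t k μ (castT (cubic d (lev L k * evenPeriod t)) z, f)) atTop (𝓝 s))
    (hZ1 : ∀ (f : Fin d) (z : Fin d → ℤ), ∃ s : ℂ, Tendsto (fun t => Z t k (castT (cubic d (lev L k * evenPeriod t)) z, f)) atTop (𝓝 s))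
    {σ : Type*} {V₁ V₂ : σ → (t : ℕ) → (k : ℕ) → Fin d → (idx L (cubic d (evenPeriod t)) k → ℂ)} {W : σ → (t : ℕ) → (k : ℕ) → (idx L (cubic d (evenPeriod t)) k → ℂ)}
    (hV₁ : ∀ i t, LipschitzBackground L (cubic d (evenPeriod t)) (V₁ i t) α β) (hV₂ : ∀ i t, LipschitzBackground L (cubic d (evenPeriod t)) (V₂ i t) α β)
    (hW : ∀ i t, BoundedBackground L (cubic d (evenPeriod t)) (W i t) α' β')
    (hV₁1 : ∀ i (μ f : Fin d) (z : Fin d → ℤ), ∃ s : ℂ, Tendsto (fun t => V₁ i t k μ (castT (cubic d (lev L k * evenPeriod t)) z, f)) atTop (𝓝 s))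
    (hV₂1 : ∀ i (μ f : Fin d) (z : Fin d → ℤ), ∃ s : ℂ, Tendsto (fun t => V₂ i t k μ (castT (cubic d (lev L k * evenPeriod t)) z, f)) atTop (𝓝 s))
    (hW1 : ∀ i (f : Fin d) (z : Fin d → ℤ), ∃ s : ℂ, Tendsto (fun t => W i t k (castT (cubic d (lev L k * evenPeriod t)) z, f)) atTop (𝓝 s))
    {u : ℂ} (hu : ‖u‖ ≤ T) (w : List σ) (f g : Fin d) (z z' : Fin d → ℤ) :
    ∃ s : ℂ, Tendsto (fun t => (List.foldr (fun i N => (calDalev L (cubic d (evenPeriod t)) a ha k + u • (Pmodel L (cubic d (evenPeriod t)) (U₁ t) k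
            + (Pmodel L (cubic d (evenPeriod t)) (U₂ t) k)ᴴ + Matrix.diagonal (Z t k)))⁻¹
          * (Pmodel L (cubic d (evenPeriod t)) (V₁ i t) k + (Pmodel L (cubic d (evenPeriod t)) (V₂ i t) k)ᴴ + Matrix.diagonal (W i t k)) * N)
        (calDalev L (cubic d (evenPeriod t)) a ha k + u • (Pmodel L (cubic d (evenPeriod t)) (U₁ t) k + (Pmodel L (cubic d (evenPeriod t)) (U₂ t) k)ᴴ
            + Matrix.diagonal (Z t k)))⁻¹ w)
      (castT (cubic d (lev L k * evenPeriod t)) z, f) (castT (cubic d (lev L k * evenPeriod t)) z', g)) atTop (𝓝 s) := by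
  have hd1 : 1 ≤ d := le_trans (by norm_num) hd
  have hd0 : (0 : ℝ) < d := by exact_mod_cast lt_of_lt_of_le zero_lt_one hd1
  have hn : (0 : ℝ) < lev L k := by exact_mod_cast Nat.pos_of_ne_zero (NeZero.ne (lev L k))
  have hside : Tendsto (fun t => lev L k * evenPeriod t) atTop atTop :=
    Filter.Tendsto.const_mul_atTop' (Nat.pos_of_ne_zero (NeZero.ne (lev L k))) tendsto_evenPeriod |>.congr fun t => by ring
  have hJγ : max (JA d a a' κ 1) 0 < gamD d a := max_JA_lt_gamD a hJA
  have hTκ : T * (2 * (d * (α₀ + β₀) * Cst d a) + α₀' * Cst d a) < 1 := by linarith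
  set C : ℝ := 2 * Real.exp (κ * 4) / (gamD d a - max (JA d a a' κ 1) 0) * Real.exp κ with hC
  have hC0 : 0 ≤ C := by have := sub_pos.mpr hJγ; positivity
  have hδ : 0 < κ / (d * lev L k) := div_pos hκ0 (mul_pos hd0 hn)
  -- `𝒢_k(u)`: decay from the right site read as decay from the left site, EL₂
  have hGr : ∀ t (x : Site d (lev L k * evenPeriod t)) (ff : Fin d) (y : Site d (lev L k * evenPeriod t)) (h : Fin d),
      ‖(calDalev L (cubic d (evenPeriod t)) a ha k + u • (Pmodel L (cubic d (evenPeriod t)) (U₁ t) k + (Pmodel L (cubic d (evenPeriod t)) (U₂ t) k)ᴴ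
          + Matrix.diagonal (Z t k)))⁻¹ (x, ff) (y, h)‖
        ≤ C * Real.exp (-(κ / (d * lev L k)) * l1 (windowMap d (lev L k * evenPeriod t) (x - y))) :=
    fun t x ff y h => fineWindowDecay_pertInv_coupling L a ha ha' hκ0 hγ' hδ' hJA hT₂ (evenPeriod t) (hU₁ t) (hU₂ t) (hZ t) hu k x y ff h
  have hGl : ∀ t (x : Site d (lev L k * evenPeriod t)) (ff : Fin d) (y : Site d (lev L k * evenPeriod t)) (h : Fin d),
      ‖(calDalev L (cubic d (evenPeriod t)) a ha k + u • (Pmodel L (cubic d (evenPeriod t)) (U₁ t) k + (Pmodel L (cubic d (evenPeriod t)) (U₂ t) k)ᴴ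
          + Matrix.diagonal (Z t k)))⁻¹ (x, ff) (y, h)‖
        ≤ C * Real.exp (-(κ / (d * lev L k)) * l1 (windowMap d (lev L k * evenPeriod t) (y - x))) := by
    intro t x ff y h
    have h' := hGr t x ff y h
    rwa [show x - y = -(y - x) from (neg_sub y x).symm, l1_windowMap_neg] at h'
  have hGel := fun ff gg w₁ w₂ => tendsto_pertInv_pair_coupling L a ha hd hTκ k hU₁ hU₂ hZ hU₁1 hU₂1 hZ1 hu ff gg w₁ w₂
  set CX : ℝ := 2 * (d * (α * lev L k * ((Real.exp (3 * (κ / (d * lev L k))) + 1) * C))) + α' * C with hCX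
  have hCX0 : 0 ≤ CX := by positivity
  -- the letters `A_i𝒢(u)`: left-window decay and EL₂
  have hXdecl : ∀ i t (x : Site d (lev L k * evenPeriod t)) (ff : Fin d) (y : Site d (lev L k * evenPeriod t)) (gg : Fin d),
      ‖((Pmodel L (cubic d (evenPeriod t)) (V₁ i t) k + (Pmodel L (cubic d (evenPeriod t)) (V₂ i t) k)ᴴ + Matrix.diagonal (W i t k))
          * (calDalev L (cubic d (evenPeriod t)) a ha k + u • (Pmodel L (cubic d (evenPeriod t)) (U₁ t) k + (Pmodel L (cubic d (evenPeriod t)) (U₂ t) k)ᴴ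
              + Matrix.diagonal (Z t k)))⁻¹) (x, ff) (y, gg)‖
        ≤ CX * Real.exp (-(κ / (d * lev L k)) * l1 (windowMap d (lev L k * evenPeriod t) (y - x))) := by
    intro i t x ff y gg
    have h := norm_couplingLetter_mul_apply_le L (evenPeriod t) (hV₁ i t) (hV₂ i t) (hW i t) k hC0 hδ.le (hGr t) x ff y gg
    rwa [show x - y = -(y - x) from (neg_sub y x).symm, l1_windowMap_neg] at h
  have hXel : ∀ i (ff gg : Fin d) (z z' : Fin d → ℤ), ∃ s : ℂ, Tendsto (fun t => ((Pmodel L (cubic d (evenPeriod t)) (V₁ i t) k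
          + (Pmodel L (cubic d (evenPeriod t)) (V₂ i t) k)ᴴ + Matrix.diagonal (W i t k))
          * (calDalev L (cubic d (evenPeriod t)) a ha k + u • (Pmodel L (cubic d (evenPeriod t)) (U₁ t) k + (Pmodel L (cubic d (evenPeriod t)) (U₂ t) k)ᴴ
              + Matrix.diagonal (Z t k)))⁻¹)
      (castT (cubic d (lev L k * evenPeriod t)) z, ff) (castT (cubic d (lev L k * evenPeriod t)) z', gg)) atTop (𝓝 s) :=
    fun i => tendsto_couplingLetter_mul_pair L (side := evenPeriod) k (V₁ i) (V₂ i) (W i) (hV₁1 i) (hV₂1 i) (hW1 i)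
      (G := fun t => (calDalev L (cubic d (evenPeriod t)) a ha k + u • (Pmodel L (cubic d (evenPeriod t)) (U₁ t) k + (Pmodel L (cubic d (evenPeriod t)) (U₂ t) k)ᴴ
        + Matrix.diagonal (Z t k)))⁻¹) hGel
  -- the right shift `T_w(u) = 𝒢(u)·R_w(u)`
  have e : ∀ t, List.foldr (fun i N => (calDalev L (cubic d (evenPeriod t)) a ha k + u • (Pmodel L (cubic d (evenPeriod t)) (U₁ t) k
            + (Pmodel L (cubic d (evenPeriod t)) (U₂ t) k)ᴴ + Matrix.diagonal (Z t k)))⁻¹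
          * (Pmodel L (cubic d (evenPeriod t)) (V₁ i t) k + (Pmodel L (cubic d (evenPeriod t)) (V₂ i t) k)ᴴ + Matrix.diagonal (W i t k)) * N)
        (calDalev L (cubic d (evenPeriod t)) a ha k + u • (Pmodel L (cubic d (evenPeriod t)) (U₁ t) k + (Pmodel L (cubic d (evenPeriod t)) (U₂ t) k)ᴴ
            + Matrix.diagonal (Z t k)))⁻¹ w
      = (calDalev L (cubic d (evenPeriod t)) a ha k + u • (Pmodel L (cubic d (evenPeriod t)) (U₁ t) k + (Pmodel L (cubic d (evenPeriod t)) (U₂ t) k)ᴴ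
            + Matrix.diagonal (Z t k)))⁻¹
        * List.foldr (fun i N => (Pmodel L (cubic d (evenPeriod t)) (V₁ i t) k + (Pmodel L (cubic d (evenPeriod t)) (V₂ i t) k)ᴴ + Matrix.diagonal (W i t k))
          * (calDalev L (cubic d (evenPeriod t)) a ha k + u • (Pmodel L (cubic d (evenPeriod t)) (U₁ t) k + (Pmodel L (cubic d (evenPeriod t)) (U₂ t) k)ᴴ
              + Matrix.diagonal (Z t k)))⁻¹ * N) 1 w :=
    fun t => chain_eq_mul_tailProd _ (fun i => (Pmodel L (cubic d (evenPeriod t)) (V₁ i t) k + (Pmodel L (cubic d (evenPeriod t)) (V₂ i t) k)ᴴ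
      + Matrix.diagonal (W i t k))) w
  simp only [e]
  exact tendsto_mul_tailWord_pair (d := d) (F := Fin d) (side := fun t => lev L k * evenPeriod t) hside
    (G := fun t => (calDalev L (cubic d (evenPeriod t)) a ha k + u • (Pmodel L (cubic d (evenPeriod t)) (U₁ t) k + (Pmodel L (cubic d (evenPeriod t)) (U₂ t) k)ᴴ
      + Matrix.diagonal (Z t k)))⁻¹)
    (A := fun i t => (Pmodel L (cubic d (evenPeriod t)) (V₁ i t) k + (Pmodel L (cubic d (evenPeriod t)) (V₂ i t) k)ᴴ + Matrix.diagonal (W i t k))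
      * (calDalev L (cubic d (evenPeriod t)) a ha k + u • (Pmodel L (cubic d (evenPeriod t)) (U₁ t) k + (Pmodel L (cubic d (evenPeriod t)) (U₂ t) k)ᴴ
        + Matrix.diagonal (Z t k)))⁻¹) hδ hCX0 hGl hXdecl hGel hXel w f g z z'

/-- **`tendsto_couplingWordAt_pair` — EL₂ OF `X_{w,k}(u) = L^{dk}Q_kT_{w,k}(u)Q_kᴴ` ON THE UNIT LATTICE, EVERY WORD, MODULO EL₁ OF ALL BACKGROUNDS** [our proof] (`d ≥ 3`, even
cubic volumes, the base letter's disc): PART 151's middle-free stencil on `tendsto_couplingWordAt_fine_pair`. [cite: Balaban1987RG1, p.264 (after (1.21): the `T ↗ ℤ^d` limit)] -/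
theorem tendsto_couplingWordAt_pair (hd : 3 ≤ d) {α₀ β₀ α₀' β₀' α β α' β' a' κ T : ℝ} (hα : 0 ≤ α) (hα' : 0 ≤ α') (ha' : 0 < a') (hκ0 : 0 < κ)
    (hγ' : Jfree d a' κ 1 < gammaPs d a') (hδ' : deltaK d a' κ 1 < sigma0 d a' ^ 2) (hJA : JA d a a' κ 1 < gamD d a)
    (hT₁ : T * (2 * (d * (α₀ + β₀) * Cst d a) + α₀' * Cst d a) ≤ 1 / 2)
    (hT₂ : T * (d * (α₀ * G2 d a (max (JA d a a' κ 1) 0) (gamD d a - max (JA d a a' κ 1) 0) κ)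
      + d * (Real.exp |κ| * (α₀ * G2 d a (max (JA d a a' κ 1) 0) (gamD d a - max (JA d a a' κ 1) 0) κ + β₀ * (gamD d a - max (JA d a a' κ 1) 0)⁻¹))
      + α₀' * (gamD d a - max (JA d a a' κ 1) 0)⁻¹) ≤ 1 / 2) (k : ℕ)
    {U₁ U₂ : (t : ℕ) → (k : ℕ) → Fin d → (idx L (cubic d (evenPeriod t)) k → ℂ)} {Z : (t : ℕ) → (k : ℕ) → (idx L (cubic d (evenPeriod t)) k → ℂ)}
    (hU₁ : ∀ t, LipschitzBackground L (cubic d (evenPeriod t)) (U₁ t) α₀ β₀) (hU₂ : ∀ t, LipschitzBackground L (cubic d (evenPeriod t)) (U₂ t) α₀ β₀)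
    (hZ : ∀ t, BoundedBackground L (cubic d (evenPeriod t)) (Z t) α₀' β₀')
    (hU₁1 : ∀ (μ f : Fin d) (z : Fin d → ℤ), ∃ s : ℂ, Tendsto (fun t => U₁ t k μ (castT (cubic d (lev L k * evenPeriod t)) z, f)) atTop (𝓝 s))
    (hU₂1 : ∀ (μ f : Fin d) (z : Fin d → ℤ), ∃ s : ℂ, Tendsto (fun t => U₂ t k μ (castT (cubic d (lev L k * evenPeriod t)) z, f)) atTop (𝓝 s))
    (hZ1 : ∀ (f : Fin d) (z : Fin d → ℤ), ∃ s : ℂ, Tendsto (fun t => Z t k (castT (cubic d (lev L k * evenPeriod t)) z, f)) atTop (𝓝 s))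
    {σ : Type*} {V₁ V₂ : σ → (t : ℕ) → (k : ℕ) → Fin d → (idx L (cubic d (evenPeriod t)) k → ℂ)} {W : σ → (t : ℕ) → (k : ℕ) → (idx L (cubic d (evenPeriod t)) k → ℂ)}
    (hV₁ : ∀ i t, LipschitzBackground L (cubic d (evenPeriod t)) (V₁ i t) α β) (hV₂ : ∀ i t, LipschitzBackground L (cubic d (evenPeriod t)) (V₂ i t) α β)
    (hW : ∀ i t, BoundedBackground L (cubic d (evenPeriod t)) (W i t) α' β')
    (hV₁1 : ∀ i (μ f : Fin d) (z : Fin d → ℤ), ∃ s : ℂ, Tendsto (fun t => V₁ i t k μ (castT (cubic d (lev L k * evenPeriod t)) z, f)) atTop (𝓝 s))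
    (hV₂1 : ∀ i (μ f : Fin d) (z : Fin d → ℤ), ∃ s : ℂ, Tendsto (fun t => V₂ i t k μ (castT (cubic d (lev L k * evenPeriod t)) z, f)) atTop (𝓝 s))
    (hW1 : ∀ i (f : Fin d) (z : Fin d → ℤ), ∃ s : ℂ, Tendsto (fun t => W i t k (castT (cubic d (lev L k * evenPeriod t)) z, f)) atTop (𝓝 s))
    {u : ℂ} (hu : ‖u‖ ≤ T) (w : List σ) (μ ν : Fin d) (z z' : Fin d → ℤ) :
    ∃ s : ℂ, Tendsto (fun t => (avgTow (QBlev L (cubic d (evenPeriod t))) ((L : ℝ) ^ d)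
        (fun k' => List.foldr (fun i N => (calDalev L (cubic d (evenPeriod t)) a ha k' + u • (Pmodel L (cubic d (evenPeriod t)) (U₁ t) k'
            + (Pmodel L (cubic d (evenPeriod t)) (U₂ t) k')ᴴ + Matrix.diagonal (Z t k')))⁻¹
          * (Pmodel L (cubic d (evenPeriod t)) (V₁ i t) k' + (Pmodel L (cubic d (evenPeriod t)) (V₂ i t) k')ᴴ + Matrix.diagonal (W i t k')) * N)
          (calDalev L (cubic d (evenPeriod t)) a ha k' + u • (Pmodel L (cubic d (evenPeriod t)) (U₁ t) k' + (Pmodel L (cubic d (evenPeriod t)) (U₂ t) k')ᴴ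
            + Matrix.diagonal (Z t k')))⁻¹ w) k)
      ((unitIdx L (cubic d (evenPeriod t))).symm (castT (cubic d (evenPeriod t)) z, μ)) ((unitIdx L (cubic d (evenPeriod t))).symm (castT (cubic d (evenPeriod t)) z', ν)))
      atTop (𝓝 s) := by
  obtain ⟨s, hs⟩ := tendsto_avgTow_pair_of_fine L k
    (X := fun t k' => List.foldr (fun i N => (calDalev L (cubic d (evenPeriod t)) a ha k' + u • (Pmodel L (cubic d (evenPeriod t)) (U₁ t) k'
            + (Pmodel L (cubic d (evenPeriod t)) (U₂ t) k')ᴴ + Matrix.diagonal (Z t k')))⁻¹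
          * (Pmodel L (cubic d (evenPeriod t)) (V₁ i t) k' + (Pmodel L (cubic d (evenPeriod t)) (V₂ i t) k')ᴴ + Matrix.diagonal (W i t k')) * N)
          (calDalev L (cubic d (evenPeriod t)) a ha k' + u • (Pmodel L (cubic d (evenPeriod t)) (U₁ t) k' + (Pmodel L (cubic d (evenPeriod t)) (U₂ t) k')ᴴ
            + Matrix.diagonal (Z t k')))⁻¹ w)
    (fun ff gg w₁ w₂ => tendsto_couplingWordAt_fine_pair L a ha hd hα hα' ha' hκ0 hγ' hδ' hJA hT₁ hT₂ k hU₁ hU₂ hZ hU₁1 hU₂1 hZ1 hV₁ hV₂ hW hV₁1 hV₂1 hW1 hu w ff gg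
      w₁ w₂) μ ν z z'
  refine ⟨s, hs.congr fun t => ?_⟩
  simp only [Matrix.reindex_apply, Matrix.submatrix_apply]

end WordLimits

/-! ## §3 The INPUT triple of every word at the base point along the even cubic volumes -/

/-- **`couplingWordAt_inputs` — THE INPUT TRIPLE ((UD), (SR), EL₂) OF `X_w(u)` ALONG THE EVEN CUBIC VOLUMES** [our proof] (`L ≥ 2`, `d ≥ 3`; base coupling letter `(α₀, β₀, α₀′, β₀′)`
on its disc, `‖u‖ ≤ T`; a family of coupling letters with common `(α, β, α′, β′)`; volume-indexed backgrounds DISPLAYING ONLY EL₁): `∃ κ₁ > 0, B, B′ ≥ 0` (free of `t, k, u`) with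
(UD)+(SR) of `X_w(u)` on every `cubic d (2(t+1))` and EL₂ at unit integer pairs — the format of PART 160's `list_prod_inputs`. -/
theorem couplingWordAt_inputs (hL : 2 ≤ L) (hd : 3 ≤ d) {α₀ β₀ α₀' β₀' α β α' β' a' κ T : ℝ} (hα₀ : 0 ≤ α₀) (hβ₀ : 0 ≤ β₀) (hα₀' : 0 ≤ α₀') (hβ₀' : 0 ≤ β₀')
    (hα : 0 ≤ α) (hβ : 0 ≤ β) (hα' : 0 ≤ α') (hβ' : 0 ≤ β') (ha' : 0 < a') (hκ0 : 0 < κ)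
    (hγ' : Jfree d a' κ 1 < gammaPs d a') (hδ' : deltaK d a' κ 1 < sigma0 d a' ^ 2) (hJA : JA d a a' κ 1 < gamD d a) (hT0 : 0 ≤ T)
    (hT₁ : T * (2 * (d * (α₀ + β₀) * Cst d a) + α₀' * Cst d a) ≤ 1 / 2)
    (hT₂ : T * (d * (α₀ * G2 d a (max (JA d a a' κ 1) 0) (gamD d a - max (JA d a a' κ 1) 0) κ)
      + d * (Real.exp |κ| * (α₀ * G2 d a (max (JA d a a' κ 1) 0) (gamD d a - max (JA d a a' κ 1) 0) κ + β₀ * (gamD d a - max (JA d a a' κ 1) 0)⁻¹))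
      + α₀' * (gamD d a - max (JA d a a' κ 1) 0)⁻¹) ≤ 1 / 2)
    {U₁ U₂ : (t : ℕ) → (k : ℕ) → Fin d → (idx L (cubic d (evenPeriod t)) k → ℂ)} {Z : (t : ℕ) → (k : ℕ) → (idx L (cubic d (evenPeriod t)) k → ℂ)}
    (hU₁ : ∀ t, LipschitzBackground L (cubic d (evenPeriod t)) (U₁ t) α₀ β₀) (hU₂ : ∀ t, LipschitzBackground L (cubic d (evenPeriod t)) (U₂ t) α₀ β₀)
    (hZ : ∀ t, BoundedBackground L (cubic d (evenPeriod t)) (Z t) α₀' β₀')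
    (hU₁1 : ∀ k (μ f : Fin d) (z : Fin d → ℤ), ∃ s : ℂ, Tendsto (fun t => U₁ t k μ (castT (cubic d (lev L k * evenPeriod t)) z, f)) atTop (𝓝 s))
    (hU₂1 : ∀ k (μ f : Fin d) (z : Fin d → ℤ), ∃ s : ℂ, Tendsto (fun t => U₂ t k μ (castT (cubic d (lev L k * evenPeriod t)) z, f)) atTop (𝓝 s))
    (hZ1 : ∀ k (f : Fin d) (z : Fin d → ℤ), ∃ s : ℂ, Tendsto (fun t => Z t k (castT (cubic d (lev L k * evenPeriod t)) z, f)) atTop (𝓝 s))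
    {σ : Type*} {V₁ V₂ : σ → (t : ℕ) → (k : ℕ) → Fin d → (idx L (cubic d (evenPeriod t)) k → ℂ)} {W : σ → (t : ℕ) → (k : ℕ) → (idx L (cubic d (evenPeriod t)) k → ℂ)}
    (hV₁ : ∀ i t, LipschitzBackground L (cubic d (evenPeriod t)) (V₁ i t) α β) (hV₂ : ∀ i t, LipschitzBackground L (cubic d (evenPeriod t)) (V₂ i t) α β)
    (hW : ∀ i t, BoundedBackground L (cubic d (evenPeriod t)) (W i t) α' β')
    (hV₁1 : ∀ i k (μ f : Fin d) (z : Fin d → ℤ), ∃ s : ℂ, Tendsto (fun t => V₁ i t k μ (castT (cubic d (lev L k * evenPeriod t)) z, f)) atTop (𝓝 s))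
    (hV₂1 : ∀ i k (μ f : Fin d) (z : Fin d → ℤ), ∃ s : ℂ, Tendsto (fun t => V₂ i t k μ (castT (cubic d (lev L k * evenPeriod t)) z, f)) atTop (𝓝 s))
    (hW1 : ∀ i k (f : Fin d) (z : Fin d → ℤ), ∃ s : ℂ, Tendsto (fun t => W i t k (castT (cubic d (lev L k * evenPeriod t)) z, f)) atTop (𝓝 s))
    {u : ℂ} (hu : ‖u‖ ≤ T) (w : List σ) :
    ∃ κ₁ B B' : ℝ, 0 < κ₁ ∧ 0 ≤ B ∧ 0 ≤ B' ∧
      (∀ t k, EntryDecay (distK L (cubic d (evenPeriod t))) (avgTow (QBlev L (cubic d (evenPeriod t))) ((L : ℝ) ^ d)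
        (fun k' => List.foldr (fun i N => (calDalev L (cubic d (evenPeriod t)) a ha k' + u • (Pmodel L (cubic d (evenPeriod t)) (U₁ t) k'
            + (Pmodel L (cubic d (evenPeriod t)) (U₂ t) k')ᴴ + Matrix.diagonal (Z t k')))⁻¹
          * (Pmodel L (cubic d (evenPeriod t)) (V₁ i t) k' + (Pmodel L (cubic d (evenPeriod t)) (V₂ i t) k')ᴴ + Matrix.diagonal (W i t k')) * N)
          (calDalev L (cubic d (evenPeriod t)) a ha k' + u • (Pmodel L (cubic d (evenPeriod t)) (U₁ t) k' + (Pmodel L (cubic d (evenPeriod t)) (U₂ t) k')ᴴ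
            + Matrix.diagonal (Z t k')))⁻¹ w) k) B κ₁) ∧
      (∀ t, TwoLevelDecayRate (distK L (cubic d (evenPeriod t))) (avgTow (QBlev L (cubic d (evenPeriod t))) ((L : ℝ) ^ d)
        (fun k' => List.foldr (fun i N => (calDalev L (cubic d (evenPeriod t)) a ha k' + u • (Pmodel L (cubic d (evenPeriod t)) (U₁ t) k'
            + (Pmodel L (cubic d (evenPeriod t)) (U₂ t) k')ᴴ + Matrix.diagonal (Z t k')))⁻¹
          * (Pmodel L (cubic d (evenPeriod t)) (V₁ i t) k' + (Pmodel L (cubic d (evenPeriod t)) (V₂ i t) k')ᴴ + Matrix.diagonal (W i t k')) * N)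
          (calDalev L (cubic d (evenPeriod t)) a ha k' + u • (Pmodel L (cubic d (evenPeriod t)) (U₁ t) k' + (Pmodel L (cubic d (evenPeriod t)) (U₂ t) k')ᴴ
            + Matrix.diagonal (Z t k')))⁻¹ w)) B' κ₁ (Real.sqrt ((L : ℝ)⁻¹))) ∧
      (∀ k μ ν (z z' : Fin d → ℤ), ∃ s' : ℂ, Tendsto (fun t => (avgTow (QBlev L (cubic d (evenPeriod t))) ((L : ℝ) ^ d)
        (fun k' => List.foldr (fun i N => (calDalev L (cubic d (evenPeriod t)) a ha k' + u • (Pmodel L (cubic d (evenPeriod t)) (U₁ t) k'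
            + (Pmodel L (cubic d (evenPeriod t)) (U₂ t) k')ᴴ + Matrix.diagonal (Z t k')))⁻¹
          * (Pmodel L (cubic d (evenPeriod t)) (V₁ i t) k' + (Pmodel L (cubic d (evenPeriod t)) (V₂ i t) k')ᴴ + Matrix.diagonal (W i t k')) * N)
          (calDalev L (cubic d (evenPeriod t)) a ha k' + u • (Pmodel L (cubic d (evenPeriod t)) (U₁ t) k' + (Pmodel L (cubic d (evenPeriod t)) (U₂ t) k')ᴴ
            + Matrix.diagonal (Z t k')))⁻¹ w) k)
        ((unitIdx L (cubic d (evenPeriod t))).symm (castT (cubic d (evenPeriod t)) z, μ)) ((unitIdx L (cubic d (evenPeriod t))).symm (castT (cubic d (evenPeriod t)) z', ν)))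
        atTop (𝓝 s')) := by
  have hd1 : 1 ≤ d := le_trans (by norm_num) hd
  obtain ⟨κ₁, B, B', hκ₁, hB, hB', h⟩ := couplingWordAt_decay_inputs L a ha hL hd1 hα₀ hβ₀ hα₀' hβ₀' hα hβ hα' hβ' ha' hκ0 hγ' hδ' hJA hT0 hT₁ hT₂ w
  exact ⟨κ₁, B, B', hκ₁, hB, hB',
    fun t k => (h (cubic d (evenPeriod t)) (U₁ t) (U₂ t) (Z t) (fun i => V₁ i t) (fun i => V₂ i t) (fun i => W i t) (hU₁ t) (hU₂ t) (hZ t) (fun i => hV₁ i t)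
      (fun i => hV₂ i t) (fun i => hW i t) u hu).1 k,
    fun t => (h (cubic d (evenPeriod t)) (U₁ t) (U₂ t) (Z t) (fun i => V₁ i t) (fun i => V₂ i t) (fun i => W i t) (hU₁ t) (hU₂ t) (hZ t) (fun i => hV₁ i t)
      (fun i => hV₂ i t) (fun i => hW i t) u hu).2,
    fun k μ ν z z' => tendsto_couplingWordAt_pair L a ha hd hα hα' ha' hκ0 hγ' hδ' hJA hT₁ hT₂ k hU₁ hU₂ hZ (hU₁1 k) (hU₂1 k) (hZ1 k) hV₁ hV₂ hW (fun i => hV₁1 i k)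
      (fun i => hV₂1 i k) (fun i => hW1 i k) hu w μ ν z z'⟩

end Summit.QuantumFields.BalabanUV.Beta.GAN24.CouplingWordsAtCouplingVolumeLimit

end
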